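import Literature.AlgebraicGeometry.AbelianSchemes.MFKTowerOfAbelianScheme
import Literature.AlgebraicGeometry.Morphisms.SmoothConnectedFibreLocusRepresents
import Literature.AlgebraicGeometry.AbelianSchemes.AbelianSchemeDualPairNormalize
import Literature.AlgebraicGeometry.AbelianSchemes.AbelianSchemeOverFibreIdentity
import Literature.AlgebraicGeometry.Morphisms.ProjectiveMorphismComposition
import HarnessLib

/-!
# [MumfordFogartyKirwan1994] Prop. 7.3, END TO END: the MFK sub-functor `H ↪ H₀` of a projective flat family with sections,
# a rank-one sheaf and a frame — steps (I) (open), (II) (open, the group law), then the tower (III)–(VI) of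
# ★ `MFKTowerOfAbelianScheme` over `H₂` — modulo the binders `hII` (Thm. 6.14) and `hF3` (Cor. 6.8)

Layer `Literature/AlgebraicGeometry/AbelianSchemes`, namespace `Literature.AlgebraicGeometry.AbelianSchemes.AbelianSchemeOver`,
universe `0`.  THEOREMS ONLY (no definition, no named fact, no instance, no notation, no `sorry`).  Cell `hodgecm-mathlib` (D-0151),
F-DAG row F-6, CAPSTONE FILE 2 (census `B-provers/B-p17/g13/CENSUS-F6-CapstoneFile2-MFKSubfunctorOfHilb.B-p17g13.md`, B-p17 (g13);
composition check and binder letters: B-p18 (g19) `CENSUS-F6-Capstone-MFKSubfunctorOfHilb` §1 and probe `HIIBinderProbe`;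
FILE 1 = ★ `MFKTowerOfAbelianScheme` (B-p02 (g14)); words B-plan1 (g17) 09:18:20Z, B-p02 (g14) 09:33:29Z).
HC_CM is proved only modulo the 7 printed citations until rung 0 closes; nothing here is about HC.

THE PRINT ([MumfordFogartyKirwan1994] Ch. 7 §2 Prop. 7.3, pp. 132–134).  From the universal family `Z₀ → H₀` of the Hilbert scheme
with its `2g+1` sections: (I) `H₁ ⊂ H₀` open = «smooth connected fibres»; (II) `H₂ ⊂ H₁` open (and closed) = «the fibre is an abelian
variety with identity `ε`», and `Z₂/H₂` IS an abelian scheme (Thm. 6.14); then (III) `N`-torsion of the sections, (IV) level structure,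
(V) `L′ ≅ L^Δ(ω)³` (Prop. 6.11) and «`Z₅` has a polarization», (V′) type/liftability, (VI) the complete linear system.  Steps (III)–(VI)
are ★ `exists_isImmersion_iff_mfkLocus` (FILE 1) for an abelian scheme `A/S` WITH its group law, a dual pair, `L₀`, sections and a frame.

WHAT THIS FILE DOES.  From RAW data over `H₀` — `p₀ : Z₀ → H₀` proper flat PROJECTIVE over a base locally of finite type over `ℚ`,
a section `ε₀`, sections `τ₀ : Fin g ⊕ Fin g → (H₀ ⟶ Z₀)`, a rank-one `L₀` on `Z₀`, a frame `u₀ : 𝒪^{6^g·deg δ} → (p₀)_*L₀` — and the two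
core binders `hII` (step (II) = MFK Thm. 6.14 with the group law as OUTPUT DATA, letter of B-p18 (g19)) and `hF3` (the F-3 dual-pair
assignment in the pen's Cor. 6.8 letter «Zariski-locally projective», B-p14 (g18) 09:11:33Z), it produces (NESTED at `H₂`, SQUARE
form): the open `j₁ : H₁ ↪ H₀` of ★ (I) with its universal property; the open `j₂ : H₂ ↪ H₁` of `hII` with its universal property
(unit clause read through `ε₀`); the abelian scheme `A₂/H₂` TOGETHER WITH a cartesian square `sq₂ : A₂ → Z₀` over `j₂ ≫ j₁` (so that
every later clause typechecks against raw data: `A₂.unitSection ≫ pr₂ = (j₂ ≫ j₁) ≫ ε₀`, sections `σ₂` with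
`(σ₂ i).left ≫ pr₂ = (j₂ ≫ j₁) ≫ τ₀ i`, the dual pair `D₂` from `hF3` normalised by ★ `DualPair.normalize`, the frame pulled back along
`j₂ ≫ j₁`); and, for every fibrewise-ampleness witness `hamp₂` of `L₀|_{A₂}` (★ (P)-closer letter; discharged at Hilb by ★ S1b
`exists_isAmple_nonempty_pullback_hyperplane_iso`), FILE 1's immersion `j : H ↪ H₂` with its `∃! ↔` over `H₂`.
§2 composes the three storeys along `j ≫ j₂ ≫ j₁ : H ↪ H₀` for an arbitrary `b : T ⟶ H₀` (★ (T1) `existsUnique_fac_comp_iff` ×2).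
NOT here: the (H-int) flattening of (I)(II) to one clause on `Z₀ ×_{H₀} T` (★ Cor. 6.6 `AbelianSchemeOverGroupLawUnique` + transport;
ed. 2), `hHilb`/the representability corollary (sequel), the `PGL`-action (F-7).

## References
* [MumfordFogartyKirwan1994] D. Mumford, J. Fogarty, F. Kirwan, *Geometric Invariant Theory*, 3rd ed. (1994), Ch. 7 §2 Prop. 7.3
  (pp. 132–134), its proof steps (I)–(VI) (pp. 132–134); Ch. 6 §3 Theorem 6.14 (p. 124); Ch. 6 §1 Corollary 6.8 (p. 118).
-/

-- `Scheme.Modules` / `SheafOfModules` are not reducible (as in Mathlib's `AlgebraicGeometry/Modules/Sheaf.lean`).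
set_option backward.isDefEq.respectTransparency false

noncomputable section

open CategoryTheory CategoryTheory.Limits AlgebraicGeometry MonoidalCategory CartesianMonoidalCategory
open scoped MonObj

namespace Literature.AlgebraicGeometry.AbelianSchemes

open Literature.AlgebraicGeometry.Motives Literature.AlgebraicGeometry.Modules Literature.AlgebraicGeometry.Morphisms
  Literature.AlgebraicGeometry.AbelianVarieties Literature.AlgebraicGeometry.ModuliOfAbelianVarieties
  Literature.AlgebraicGeometry.KTheory

namespace AbelianSchemeOver

variable {H₀ Z₀ : Scheme.{0}} (f₀ : H₀ ⟶ Spec (.of ℚ)) [LocallyOfFiniteType f₀]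
  (p₀ : Z₀ ⟶ H₀) [IsProper p₀] [Flat p₀] (hproj : IsProjective p₀)
  (ε₀ : H₀ ⟶ Z₀) (hε₀ : ε₀ ≫ p₀ = 𝟙 H₀) {g : ℕ}
  (τ₀ : Fin g ⊕ Fin g → (H₀ ⟶ Z₀)) (hτ₀ : ∀ i, τ₀ i ≫ p₀ = 𝟙 H₀)
  (L₀ : Z₀.Modules) (hL₀ : HasRank L₀ 1) {N : ℕ} (hN : N ≠ 0) (δ : Fin g → ℕ) (hδ : IsPolarizationType δ)
  (u₀ : freeModule H₀ (Fin (6 ^ g * polarizationDegree δ)) ⟶ (Scheme.Modules.pushforward p₀).obj L₀)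
  -- `hII` (step (II), [MumfordFogartyKirwan1994] Thm. 6.14 with the group law as output DATA; letter of B-p18 (g19))
  (hII : ∀ ⦃H₁ Z₁ : Scheme.{0}⦄ (p₁ : Z₁ ⟶ H₁) [IsProper p₁] [Smooth p₁] [GeometricallyConnected p₁]
      (f₁ : H₁ ⟶ Spec (.of ℚ)) [LocallyOfFiniteType f₁] (ε₁ : H₁ ⟶ Z₁) (_ : ε₁ ≫ p₁ = 𝟙 H₁),
    ∃ (H₂ : Scheme.{0}) (j₂ : H₂ ⟶ H₁) (_ : IsOpenImmersion j₂) (_ : IsClosed (Set.range j₂))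
      (G : GrpObj (Over.mk (pullback.snd p₁ j₂))),
        (@MonObj.one _ _ _ (Over.mk (pullback.snd p₁ j₂)) G.toMonObj).left ≫ pullback.fst p₁ j₂ = j₂ ≫ ε₁ ∧
        SmoothOfRelativeDimension g (pullback.snd p₁ j₂) ∧
        ∀ ⦃T : Scheme.{0}⦄ (v : T ⟶ H₁),
          (∃! w : T ⟶ H₂, w ≫ j₂ = v) ↔
            ∃ G' : GrpObj (Over.mk (pullback.snd p₁ v)),
              (@MonObj.one _ _ _ (Over.mk (pullback.snd p₁ v)) G'.toMonObj).left ≫ pullback.fst p₁ v = v ≫ ε₁ ∧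
              SmoothOfRelativeDimension g (pullback.snd p₁ v))
  -- `hII′` (edition 2 = repairs (β)+(γ): [MumfordFogartyKirwan1994] Prop. 6.16 (p. 126) for `p₁` PROJECTIVE — the REPRESENTABILITY
  -- half of Thm. 6.14 / Prop. 7.3 step (II) only: (β) print has projective where `hII` above has proper (REF1 m14, s279 (2));
  -- (γ) the `IsClosed (Set.range j₂)` conjunct of `hII` is DROPPED — this file never used it (the destructuring below
  -- discarded it), so Koizumi's closedness theorem leaves the chain (B-p17 (g15) census 886dfb47 §0, REF1 (g14) m03))
  (hII' : ∀ ⦃H₁ Z₁ : Scheme.{0}⦄ (p₁ : Z₁ ⟶ H₁) [IsProper p₁] [Smooth p₁] [GeometricallyConnected p₁] (_ : IsProjective p₁)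
      (f₁ : H₁ ⟶ Spec (.of ℚ)) [LocallyOfFiniteType f₁] (ε₁ : H₁ ⟶ Z₁) (_ : ε₁ ≫ p₁ = 𝟙 H₁),
    ∃ (H₂ : Scheme.{0}) (j₂ : H₂ ⟶ H₁) (_ : IsOpenImmersion j₂)
      (G : GrpObj (Over.mk (pullback.snd p₁ j₂))),
        (@MonObj.one _ _ _ (Over.mk (pullback.snd p₁ j₂)) G.toMonObj).left ≫ pullback.fst p₁ j₂ = j₂ ≫ ε₁ ∧
        SmoothOfRelativeDimension g (pullback.snd p₁ j₂) ∧
        ∀ ⦃T : Scheme.{0}⦄ (v : T ⟶ H₁),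
          (∃! w : T ⟶ H₂, w ≫ j₂ = v) ↔
            ∃ G' : GrpObj (Over.mk (pullback.snd p₁ v)),
              (@MonObj.one _ _ _ (Over.mk (pullback.snd p₁ v)) G'.toMonObj).left ≫ pullback.fst p₁ v = v ≫ ε₁ ∧
              SmoothOfRelativeDimension g (pullback.snd p₁ v))
  -- `hF3` (pen (L), [MumfordFogartyKirwan1994] Cor. 6.8 Zariski-locally on the base)
  (hF3 : ∀ ⦃S : Scheme.{0}⦄ [IsLocallyNoetherian S] (fS : S ⟶ Spec (.of ℚ)) (A : AbelianSchemeOver S),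
    (∀ s : S, ∃ (U : Scheme.{0}) (i : U ⟶ S) (_ : IsOpenImmersion i) (_ : s ∈ Set.range i.base)
        (B : AbelianSchemeOver U) (G : B.X.left ⟶ A.X.left), B.IsBaseChangeVia A i G ∧ IsProjective B.X.hom) →
      Nonempty A.DualPair)
  -- `hF3′` ([MumfordFogartyKirwan1994] Ch. 0 §5 (d) (pp. 24–25, locally Noetherian base) + Cor. 6.8 (p. 118; 6.7–6.8 local on `S`) VERBATIM —
  -- the dual of a PROJECTIVE abelian scheme — over locally Noetherian `ℚ`-bases; REF1 (g13) m17 ≤-print ✓)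
  (hF3' : ∀ ⦃S : Scheme.{0}⦄ [IsLocallyNoetherian S] (_ : S ⟶ Spec (.of ℚ)) (A : AbelianSchemeOver S),
    IsProjective A.X.hom → Nonempty A.DualPair)

/-! ## §1 THE HEAD, nested at `H₂`: (I) + (II) + the tower over the resulting abelian scheme -/

include f₀ hproj hε₀ hτ₀ hL₀ hN hδ hII hF3 in
/-- **[MumfordFogartyKirwan1994] Prop. 7.3, END TO END modulo Thm. 6.14 (`hII`) and the dual pair (`hF3`)**, nested at the
(II)-locus.  From the raw data over `H₀` there are: an OPEN immersion `j₁ : H₁ ⟶ H₀` such that `b : T ⟶ H₀` factors uniquely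
through `j₁` iff `Z₀ ×_{H₀} T → T` is smooth with geometrically connected fibres (★ (I)); an OPEN immersion `j₂ : H₂ ⟶ H₁` such that
`v₁ : T ⟶ H₁` factors uniquely through `j₂` iff `Z₁ ×_{H₁} T → T` carries a group-scheme structure with unit the restriction of `ε₀`
and is smooth of relative dimension `g` (`hII`); an ABELIAN SCHEME `A₂/H₂` of relative dimension `g` with a CARTESIAN SQUARE
`sq₂ : A₂ → Z₀` over `j₂ ≫ j₁` (its family IS `Z₀ ×_{H₀} H₂`), whose unit is the restriction of `ε₀`, with sections `σ₂` restricting the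
`τ₀ i`, a dual pair `D₂` with the unit hypothesis, and the free-module identification `eF` of `(j₂ ≫ j₁)^*𝒪^{r}`; and THEN, for every
witness `hamp₂` that `L₀|_{A₂}` is fibrewise ample (the (P)-closer letter), FILE 1's tower: `Λ(L′)`, an IMMERSION `j : H ⟶ H₂` and, for
every locally Noetherian `T` and `v : T ⟶ H₂`, `v` factors uniquely through `j` iff the five MFK clauses (V), (P)+(V′-type),
(III)(IV)(V′-liftability), (VI) hold on `A₂ ×_{H₂} T` for the data `(D₂, L₀|_{A₂}, σ₂, (j₂ ≫ j₁)^*u₀)` — ★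
`exists_isImmersion_iff_mfkLocus` at `S := H₂`.  The dual pair comes from `hF3` applied ONCE, to `A₂ → H₂` (projective: ★
`IsProjective.pullback_snd` twice from `hproj`; the (L)-premise with `U := H₂`, `i := 𝟙`, ★ `isBaseChangeVia_id_of_isMonHom`), and is
normalised by ★ `DualPair.normalize` (unit hypothesis ★ `nonempty_unitHatSlice_iso_normalize`).
[cite: MumfordFogartyKirwan1994, Ch. 7 §2 Proposition 7.3 (pp. 132–134)] [cite: MumfordFogartyKirwan1994, Ch. 6 §3 Theorem 6.14 (p. 124)]
[cite: MumfordFogartyKirwan1994, Ch. 6 §1 Corollary 6.8 (p. 118)] -/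
theorem exists_isImmersion_iff_mfkSubfunctor :
    ∃ (H₁ : Scheme.{0}) (j₁ : H₁ ⟶ H₀) (_ : IsOpenImmersion j₁)
      (H₂ : Scheme.{0}) (j₂ : H₂ ⟶ H₁) (_ : IsOpenImmersion j₂)
      (A₂ : AbelianSchemeOver H₂) (pr₂ : A₂.X.left ⟶ Z₀) (sq₂ : IsPullback pr₂ A₂.X.hom p₀ (j₂ ≫ j₁))
      (_ : A₂.IsOfRelDim g) (_ : A₂.unitSection ≫ pr₂ = (j₂ ≫ j₁) ≫ ε₀)
      (σ₂ : Fin g ⊕ Fin g → A₂.Sections) (_ : ∀ i, (σ₂ i).left ≫ pr₂ = (j₂ ≫ j₁) ≫ τ₀ i)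
      (D₂ : A₂.DualPair)
      (_ : Nonempty ((Scheme.Modules.pullback (DualPair.unitHatSlice D₂)).obj D₂.P ≅ SheafOfModules.unit _))
      (eF : (Scheme.Modules.pullback (j₂ ≫ j₁)).obj (freeModule H₀ (Fin (6 ^ g * polarizationDegree δ))) ≅
        freeModule H₂ (Fin (6 ^ g * polarizationDegree δ))),
      -- (I)
      (∀ {T XT : Scheme.{0}} (b : T ⟶ H₀) {pr : XT ⟶ Z₀} {pT : XT ⟶ T} (_ : IsPullback pr pT p₀ b),
          (∃! v₁ : T ⟶ H₁, v₁ ≫ j₁ = b) ↔ Smooth pT ∧ GeometricallyConnected pT) ∧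
      -- (II)
      (∀ ⦃T : Scheme.{0}⦄ (v₁ : T ⟶ H₁),
          (∃! v : T ⟶ H₂, v ≫ j₂ = v₁) ↔
            ∃ G' : GrpObj (Over.mk (pullback.snd (pullback.snd p₀ j₁) v₁)),
              (@MonObj.one _ _ _ (Over.mk (pullback.snd (pullback.snd p₀ j₁) v₁)) G'.toMonObj).left ≫
                  pullback.fst (pullback.snd p₀ j₁) v₁ ≫ pullback.fst p₀ j₁ = (v₁ ≫ j₁) ≫ ε₀ ∧
              SmoothOfRelativeDimension g (pullback.snd (pullback.snd p₀ j₁) v₁)) ∧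
      -- (III)–(VI): FILE 1 over `H₂`, given fibrewise ampleness of `L₀|_{A₂}`
      ∀ (_ : ∀ ⦃Ω : Type⦄ [Field Ω] [IsAlgClosed Ω] (s : Spec (.of Ω) ⟶ H₂),
            ∃ Θ : CartierDivisor (A₂.fibre s).toAbelianVariety.X.left, Θ.IsAmple ∧
              Nonempty ((Scheme.Modules.pullback (X := (A₂.fibre s).toAbelianVariety.X.left)
                (pullback.fst A₂.X.hom s)).obj ((Scheme.Modules.pullback pr₂).obj L₀) ≅ A₂.lineBundleOfDivisor s Θ)),
        ∃ (lam : A₂.X ⟶ D₂.hat.X) (_ : IsMonHom lam)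
          (_ : ∀ ⦃U : Over H₂⦄ (a : U ⟶ A₂.X),
            Nonempty ((Scheme.Modules.pullback (A₂.X ◁ (a ≫ lam)).left).obj D₂.P ≅
              (Scheme.Modules.pullback (A₂.X ◁ a).left).obj (A₂.mumfordBundle
                (tensorObj ((Scheme.Modules.pullback pr₂).obj L₀) ((Scheme.Modules.pullback A₂.X.hom).obj
                  (Modules.dual ((Scheme.Modules.pullback A₂.unitSection).obj
                    ((Scheme.Modules.pullback pr₂).obj L₀))))))))
          (H : Scheme.{0}) (j : H ⟶ H₂), IsImmersion j ∧
          ∀ ⦃T : Scheme.{0}⦄ [IsLocallyNoetherian T] (v : T ⟶ H₂),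
            (∃! w : T ⟶ H, w ≫ j = v) ↔
              ∃ (ω : (A₂.baseChange v).X ⟶ (D₂.hat.baseChange v).X)
                (Γ₁ : (A₂.baseChange v).left ⟶ A₂.prodLeft D₂.hat),
                IsMonHom ω ∧ ((𝟙 (A₂.baseChange v).X) ^ 6) ≫ ω = (Over.pullback v).map lam ∧
                  Γ₁ ≫ pullback.fst A₂.X.hom D₂.hat.X.hom = pullback.fst A₂.X.hom v ∧
                  Γ₁ ≫ pullback.snd A₂.X.hom D₂.hat.X.hom = ω.left ≫ pullback.fst D₂.hat.X.hom v ∧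
                  Nonempty ((Scheme.Modules.pullback (pullback.fst A₂.X.hom v)).obj
                      (tensorObj ((Scheme.Modules.pullback pr₂).obj L₀) ((Scheme.Modules.pullback A₂.X.hom).obj
                        (Modules.dual ((Scheme.Modules.pullback A₂.unitSection).obj
                          ((Scheme.Modules.pullback pr₂).obj L₀))))) ≅
                    tensorPow ((Scheme.Modules.pullback Γ₁).obj D₂.P) 3) ∧
                  ∃ pol : (A₂.baseChange v).Polarization (D₂.baseChange v), pol.lam = ω ∧ pol.HasType δ ∧
                    (∃ φ : LevelStructure g N (A₂.baseChange v),
                      (∀ i, φ.σ i = A₂.sectionBaseChange v (σ₂ i)) ∧ φ.IsSymplecticLiftable pol δ) ∧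
                    IsIso ((Scheme.Modules.pullback v).map
                        (eF.inv ≫ (Scheme.Modules.pullback (j₂ ≫ j₁)).map u₀ ≫ pushforwardBaseChangeHom sq₂.w L₀) ≫
                      pushforwardBaseChangeHom (IsPullback.of_hasPullback A₂.X.hom v).w
                        ((Scheme.Modules.pullback pr₂).obj L₀)) := by
  haveI : IsLocallyNoetherian H₀ := LocallyOfFiniteType.isLocallyNoetherian f₀
  -- (I): the open locus of smooth geometrically connected fibres
  obtain ⟨H₁, j₁, hj₁, -, hrep₁⟩ :=
    exists_isOpenImmersion_forall_existsUnique_comp_eq_iff_smooth_and_geometricallyConnected p₀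
  haveI := hj₁
  have hI : Smooth (pullback.snd p₀ j₁) ∧ GeometricallyConnected (pullback.snd p₀ j₁) :=
    (hrep₁ j₁ (IsPullback.of_hasPullback p₀ j₁)).1
      ⟨𝟙 _, Category.id_comp _, fun _ hw => (cancel_mono j₁).1 (hw.trans (Category.id_comp _).symm)⟩
  haveI := hI.1
  haveI := hI.2
  -- the section of the restricted family, and (II)
  let ε₁ : H₁ ⟶ pullback p₀ j₁ :=
    pullback.lift (j₁ ≫ ε₀) (𝟙 H₁) (by rw [Category.assoc, hε₀, Category.comp_id, Category.id_comp])
  have hε₁ : ε₁ ≫ pullback.snd p₀ j₁ = 𝟙 H₁ := pullback.lift_snd _ _ _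
  have hε₁' : ε₁ ≫ pullback.fst p₀ j₁ = j₁ ≫ ε₀ := pullback.lift_fst _ _ _
  obtain ⟨H₂, j₂, hj₂, -, G, hunit, hg₂, hrep₂⟩ := hII (pullback.snd p₀ j₁) (j₁ ≫ f₀) ε₁ hε₁
  haveI := hj₂
  -- the abelian scheme `A₂ := (Z₁ ×_{H₁} H₂ → H₂, G)`
  let A₂ : AbelianSchemeOver H₂ :=
    @AbelianSchemeOver.mk H₂ (Over.mk (pullback.snd (pullback.snd p₀ j₁) j₂)) G
      (show IsProper (pullback.snd (pullback.snd p₀ j₁) j₂) from inferInstance)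
      (show Smooth (pullback.snd (pullback.snd p₀ j₁) j₂) from inferInstance)
      (show GeometricallyConnected (pullback.snd (pullback.snd p₀ j₁) j₂) from inferInstance)
  have hA₂ : A₂.IsOfRelDim g := hg₂
  -- the square onto `p₀`
  let pr₂ : A₂.X.left ⟶ Z₀ := pullback.fst (pullback.snd p₀ j₁) j₂ ≫ pullback.fst p₀ j₁
  have sq₂ : IsPullback pr₂ A₂.X.hom p₀ (j₂ ≫ j₁) :=
    (IsPullback.of_hasPullback (pullback.snd p₀ j₁) j₂).paste_horiz (IsPullback.of_hasPullback p₀ j₁)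
  -- the unit
  have hunit' : A₂.unitSection ≫ pr₂ = (j₂ ≫ j₁) ≫ ε₀ := by
    change (@MonObj.one _ _ _ (Over.mk (pullback.snd (pullback.snd p₀ j₁) j₂)) G.toMonObj).left ≫
        pullback.fst (pullback.snd p₀ j₁) j₂ ≫ pullback.fst p₀ j₁ = (j₂ ≫ j₁) ≫ ε₀
    rw [← Category.assoc, hunit, Category.assoc, hε₁', Category.assoc]
  -- the sections
  have hτ₁ : ∀ i, (((j₂ ≫ j₁) ≫ τ₀ i) ≫ p₀ = j₂ ≫ j₁) := fun i => by
    rw [Category.assoc, hτ₀, Category.comp_id]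
  let t₂ : ∀ i : Fin g ⊕ Fin g, H₂ ⟶ A₂.X.left := fun i =>
    pullback.lift (pullback.lift ((j₂ ≫ j₁) ≫ τ₀ i) j₂ (hτ₁ i)) (𝟙 H₂)
      (by rw [pullback.lift_snd, Category.id_comp])
  have ht₂ : ∀ i, t₂ i ≫ A₂.X.hom = 𝟙 H₂ := fun i => pullback.lift_snd _ _ _
  let σ₂ : Fin g ⊕ Fin g → A₂.Sections := fun i =>
    Over.homMk (t₂ i) (by rw [ht₂ i]; rfl)
  have hσ₂ : ∀ i, (σ₂ i).left ≫ pr₂ = (j₂ ≫ j₁) ≫ τ₀ i := fun i => by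
    change t₂ i ≫ pullback.fst (pullback.snd p₀ j₁) j₂ ≫ pullback.fst p₀ j₁ = _
    rw [← Category.assoc, pullback.lift_fst, pullback.lift_fst]
  -- the dual pair over `H₂` from `hF3` (Cor. 6.8: `A₂ → H₂` projective), normalised
  haveI : IsLocallyNoetherian H₂ := LocallyOfFiniteType.isLocallyNoetherian (j₂ ≫ j₁ ≫ f₀)
  have hproj₂ : IsProjective A₂.X.hom := (hproj.pullback_snd j₁).pullback_snd j₂
  obtain ⟨D₀⟩ := hF3 (j₂ ≫ j₁ ≫ f₀) A₂ fun s =>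
    ⟨H₂, 𝟙 H₂, inferInstance, ⟨s, rfl⟩, A₂, 𝟙 A₂.X.left,
      by simpa using isBaseChangeVia_id_of_isMonHom A₂ A₂ (𝟙 A₂.X), hproj₂⟩
  let D₂ : A₂.DualPair := D₀.normalize
  have hD₂ := D₀.nonempty_unitHatSlice_iso_normalize
  -- the frame pulled back to `H₂`
  obtain ⟨eF⟩ := nonempty_pullbackFreeIso (j₂ ≫ j₁) (Fin (6 ^ g * polarizationDegree δ))
  refine ⟨H₁, j₁, hj₁, H₂, j₂, hj₂, A₂, pr₂, sq₂, hA₂, hunit', σ₂, hσ₂, D₂, hD₂, eF, hrep₁, ?_, ?_⟩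
  · -- (II): the unit clause read through `ε₀`
    intro T v₁
    refine (hrep₂ v₁).trans ⟨?_, ?_⟩
    · rintro ⟨G', h1, h2⟩
      exact ⟨G', by rw [← Category.assoc, h1, Category.assoc, hε₁', Category.assoc], h2⟩
    · rintro ⟨G', h1, h2⟩
      -- a section `e` of `Z₁ ×_{H₁} T → T` with `e ≫ pr ≫ pr = (v₁ ≫ j₁) ≫ ε₀` has `e ≫ pr = v₁ ≫ ε₁`
      have key : ∀ e : T ⟶ pullback (pullback.snd p₀ j₁) v₁, e ≫ pullback.snd (pullback.snd p₀ j₁) v₁ = 𝟙 T →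
          e ≫ pullback.fst (pullback.snd p₀ j₁) v₁ ≫ pullback.fst p₀ j₁ = (v₁ ≫ j₁) ≫ ε₀ →
            e ≫ pullback.fst (pullback.snd p₀ j₁) v₁ = v₁ ≫ ε₁ := by
        intro e he he'
        apply pullback.hom_ext
        · rw [Category.assoc, he', Category.assoc, Category.assoc, hε₁']
        · rw [Category.assoc, pullback.condition, ← Category.assoc, he, Category.id_comp, Category.assoc, hε₁,
            Category.comp_id]
      exact ⟨G', key _ (Over.w _) h1, h2⟩
  · -- (III)–(VI): FILE 1 over `H₂`
    intro hamp₂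
    exact exists_isImmersion_iff_mfkLocus Cardinal.mk_le_aleph0 (j₂ ≫ j₁ ≫ f₀) A₂ hA₂ D₂ hD₂
      ((Scheme.Modules.pullback pr₂).obj L₀) (hasRank_pullback _ hL₀) hamp₂ hN δ hδ σ₂
      (eF.inv ≫ (Scheme.Modules.pullback (j₂ ≫ j₁)).map u₀ ≫ pushforwardBaseChangeHom sq₂.w L₀)

include f₀ hproj hε₀ hτ₀ hL₀ hN hδ hII' hF3' in
/-- **Edition 2 — the same head under the PRINT-EXACT step (II) letter `hII′` (`p₁` PROJECTIVE, [MumfordFogartyKirwan1994] Thm. 6.14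
verbatim; REF1 m14 ∕ director s279 (2) repair (β)) and the PRINT-EXACT dual-pair letter `hF3′` (the dual of a PROJECTIVE abelian scheme over
a locally Noetherian `ℚ`-base, [MumfordFogartyKirwan1994] Ch. 0 §5 (d) + Cor. 6.8; REF1 m17 repair (β′)).**  Statement and proof are
those of `exists_isImmersion_iff_mfkSubfunctor` token for token, except that `hII′` is applied to the restricted family `Z₀ ×_{H₀} H₁ → H₁`,
which IS projective (★ `IsProjective.pullback_snd` from `hproj`), and `hF3′` to the projective `A₂ → H₂` directly.  [MumfordFogartyKirwan1994] Prop. 7.3, END TO END modulo Thm. 6.14 (`hII′`) and the dual pair (`hF3`), nested at the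
(II)-locus.  From the raw data over `H₀` there are: an OPEN immersion `j₁ : H₁ ⟶ H₀` such that `b : T ⟶ H₀` factors uniquely
through `j₁` iff `Z₀ ×_{H₀} T → T` is smooth with geometrically connected fibres (★ (I)); an OPEN immersion `j₂ : H₂ ⟶ H₁` such that
`v₁ : T ⟶ H₁` factors uniquely through `j₂` iff `Z₁ ×_{H₁} T → T` carries a group-scheme structure with unit the restriction of `ε₀`
and is smooth of relative dimension `g` (`hII`); an ABELIAN SCHEME `A₂/H₂` of relative dimension `g` with a CARTESIAN SQUARE
`sq₂ : A₂ → Z₀` over `j₂ ≫ j₁` (its family IS `Z₀ ×_{H₀} H₂`), whose unit is the restriction of `ε₀`, with sections `σ₂` restricting the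
`τ₀ i`, a dual pair `D₂` with the unit hypothesis, and the free-module identification `eF` of `(j₂ ≫ j₁)^*𝒪^{r}`; and THEN, for every
witness `hamp₂` that `L₀|_{A₂}` is fibrewise ample (the (P)-closer letter), FILE 1's tower: `Λ(L′)`, an IMMERSION `j : H ⟶ H₂` and, for
every locally Noetherian `T` and `v : T ⟶ H₂`, `v` factors uniquely through `j` iff the five MFK clauses (V), (P)+(V′-type),
(III)(IV)(V′-liftability), (VI) hold on `A₂ ×_{H₂} T` for the data `(D₂, L₀|_{A₂}, σ₂, (j₂ ≫ j₁)^*u₀)` — ★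
`exists_isImmersion_iff_mfkLocus` at `S := H₂`.  The dual pair comes from `hF3` applied ONCE, to `A₂ → H₂` (projective: ★
`IsProjective.pullback_snd` twice from `hproj`; the (L)-premise with `U := H₂`, `i := 𝟙`, ★ `isBaseChangeVia_id_of_isMonHom`), and is
normalised by ★ `DualPair.normalize` (unit hypothesis ★ `nonempty_unitHatSlice_iso_normalize`).
[cite: MumfordFogartyKirwan1994, Ch. 7 §2 Proposition 7.3 (pp. 132–134)] [cite: MumfordFogartyKirwan1994, Ch. 6 §3 Theorem 6.14 (p. 124)]
[cite: MumfordFogartyKirwan1994, Ch. 6 §1 Corollary 6.8 (p. 118)] -/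
theorem exists_isImmersion_iff_mfkSubfunctor' :
    ∃ (H₁ : Scheme.{0}) (j₁ : H₁ ⟶ H₀) (_ : IsOpenImmersion j₁)
      (H₂ : Scheme.{0}) (j₂ : H₂ ⟶ H₁) (_ : IsOpenImmersion j₂)
      (A₂ : AbelianSchemeOver H₂) (pr₂ : A₂.X.left ⟶ Z₀) (sq₂ : IsPullback pr₂ A₂.X.hom p₀ (j₂ ≫ j₁))
      (_ : A₂.IsOfRelDim g) (_ : A₂.unitSection ≫ pr₂ = (j₂ ≫ j₁) ≫ ε₀)
      (σ₂ : Fin g ⊕ Fin g → A₂.Sections) (_ : ∀ i, (σ₂ i).left ≫ pr₂ = (j₂ ≫ j₁) ≫ τ₀ i)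
      (D₂ : A₂.DualPair)
      (_ : Nonempty ((Scheme.Modules.pullback (DualPair.unitHatSlice D₂)).obj D₂.P ≅ SheafOfModules.unit _))
      (eF : (Scheme.Modules.pullback (j₂ ≫ j₁)).obj (freeModule H₀ (Fin (6 ^ g * polarizationDegree δ))) ≅
        freeModule H₂ (Fin (6 ^ g * polarizationDegree δ))),
      -- (I)
      (∀ {T XT : Scheme.{0}} (b : T ⟶ H₀) {pr : XT ⟶ Z₀} {pT : XT ⟶ T} (_ : IsPullback pr pT p₀ b),
          (∃! v₁ : T ⟶ H₁, v₁ ≫ j₁ = b) ↔ Smooth pT ∧ GeometricallyConnected pT) ∧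
      -- (II)
      (∀ ⦃T : Scheme.{0}⦄ (v₁ : T ⟶ H₁),
          (∃! v : T ⟶ H₂, v ≫ j₂ = v₁) ↔
            ∃ G' : GrpObj (Over.mk (pullback.snd (pullback.snd p₀ j₁) v₁)),
              (@MonObj.one _ _ _ (Over.mk (pullback.snd (pullback.snd p₀ j₁) v₁)) G'.toMonObj).left ≫
                  pullback.fst (pullback.snd p₀ j₁) v₁ ≫ pullback.fst p₀ j₁ = (v₁ ≫ j₁) ≫ ε₀ ∧
              SmoothOfRelativeDimension g (pullback.snd (pullback.snd p₀ j₁) v₁)) ∧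
      -- (III)–(VI): FILE 1 over `H₂`, given fibrewise ampleness of `L₀|_{A₂}`
      ∀ (_ : ∀ ⦃Ω : Type⦄ [Field Ω] [IsAlgClosed Ω] (s : Spec (.of Ω) ⟶ H₂),
            ∃ Θ : CartierDivisor (A₂.fibre s).toAbelianVariety.X.left, Θ.IsAmple ∧
              Nonempty ((Scheme.Modules.pullback (X := (A₂.fibre s).toAbelianVariety.X.left)
                (pullback.fst A₂.X.hom s)).obj ((Scheme.Modules.pullback pr₂).obj L₀) ≅ A₂.lineBundleOfDivisor s Θ)),
        ∃ (lam : A₂.X ⟶ D₂.hat.X) (_ : IsMonHom lam)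
          (_ : ∀ ⦃U : Over H₂⦄ (a : U ⟶ A₂.X),
            Nonempty ((Scheme.Modules.pullback (A₂.X ◁ (a ≫ lam)).left).obj D₂.P ≅
              (Scheme.Modules.pullback (A₂.X ◁ a).left).obj (A₂.mumfordBundle
                (tensorObj ((Scheme.Modules.pullback pr₂).obj L₀) ((Scheme.Modules.pullback A₂.X.hom).obj
                  (Modules.dual ((Scheme.Modules.pullback A₂.unitSection).obj
                    ((Scheme.Modules.pullback pr₂).obj L₀))))))))
          (H : Scheme.{0}) (j : H ⟶ H₂), IsImmersion j ∧
          ∀ ⦃T : Scheme.{0}⦄ [IsLocallyNoetherian T] (v : T ⟶ H₂),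
            (∃! w : T ⟶ H, w ≫ j = v) ↔
              ∃ (ω : (A₂.baseChange v).X ⟶ (D₂.hat.baseChange v).X)
                (Γ₁ : (A₂.baseChange v).left ⟶ A₂.prodLeft D₂.hat),
                IsMonHom ω ∧ ((𝟙 (A₂.baseChange v).X) ^ 6) ≫ ω = (Over.pullback v).map lam ∧
                  Γ₁ ≫ pullback.fst A₂.X.hom D₂.hat.X.hom = pullback.fst A₂.X.hom v ∧
                  Γ₁ ≫ pullback.snd A₂.X.hom D₂.hat.X.hom = ω.left ≫ pullback.fst D₂.hat.X.hom v ∧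
                  Nonempty ((Scheme.Modules.pullback (pullback.fst A₂.X.hom v)).obj
                      (tensorObj ((Scheme.Modules.pullback pr₂).obj L₀) ((Scheme.Modules.pullback A₂.X.hom).obj
                        (Modules.dual ((Scheme.Modules.pullback A₂.unitSection).obj
                          ((Scheme.Modules.pullback pr₂).obj L₀))))) ≅
                    tensorPow ((Scheme.Modules.pullback Γ₁).obj D₂.P) 3) ∧
                  ∃ pol : (A₂.baseChange v).Polarization (D₂.baseChange v), pol.lam = ω ∧ pol.HasType δ ∧
                    (∃ φ : LevelStructure g N (A₂.baseChange v),
                      (∀ i, φ.σ i = A₂.sectionBaseChange v (σ₂ i)) ∧ φ.IsSymplecticLiftable pol δ) ∧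
                    IsIso ((Scheme.Modules.pullback v).map
                        (eF.inv ≫ (Scheme.Modules.pullback (j₂ ≫ j₁)).map u₀ ≫ pushforwardBaseChangeHom sq₂.w L₀) ≫
                      pushforwardBaseChangeHom (IsPullback.of_hasPullback A₂.X.hom v).w
                        ((Scheme.Modules.pullback pr₂).obj L₀)) := by
  haveI : IsLocallyNoetherian H₀ := LocallyOfFiniteType.isLocallyNoetherian f₀
  -- (I): the open locus of smooth geometrically connected fibres
  obtain ⟨H₁, j₁, hj₁, -, hrep₁⟩ :=
    exists_isOpenImmersion_forall_existsUnique_comp_eq_iff_smooth_and_geometricallyConnected p₀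
  haveI := hj₁
  have hI : Smooth (pullback.snd p₀ j₁) ∧ GeometricallyConnected (pullback.snd p₀ j₁) :=
    (hrep₁ j₁ (IsPullback.of_hasPullback p₀ j₁)).1
      ⟨𝟙 _, Category.id_comp _, fun _ hw => (cancel_mono j₁).1 (hw.trans (Category.id_comp _).symm)⟩
  haveI := hI.1
  haveI := hI.2
  -- the section of the restricted family, and (II)
  let ε₁ : H₁ ⟶ pullback p₀ j₁ :=
    pullback.lift (j₁ ≫ ε₀) (𝟙 H₁) (by rw [Category.assoc, hε₀, Category.comp_id, Category.id_comp])
  have hε₁ : ε₁ ≫ pullback.snd p₀ j₁ = 𝟙 H₁ := pullback.lift_snd _ _ _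
  have hε₁' : ε₁ ≫ pullback.fst p₀ j₁ = j₁ ≫ ε₀ := pullback.lift_fst _ _ _
  obtain ⟨H₂, j₂, hj₂, G, hunit, hg₂, hrep₂⟩ := hII' (pullback.snd p₀ j₁) (hproj.pullback_snd j₁) (j₁ ≫ f₀) ε₁ hε₁
  haveI := hj₂
  -- the abelian scheme `A₂ := (Z₁ ×_{H₁} H₂ → H₂, G)`
  let A₂ : AbelianSchemeOver H₂ :=
    @AbelianSchemeOver.mk H₂ (Over.mk (pullback.snd (pullback.snd p₀ j₁) j₂)) G
      (show IsProper (pullback.snd (pullback.snd p₀ j₁) j₂) from inferInstance)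
      (show Smooth (pullback.snd (pullback.snd p₀ j₁) j₂) from inferInstance)
      (show GeometricallyConnected (pullback.snd (pullback.snd p₀ j₁) j₂) from inferInstance)
  have hA₂ : A₂.IsOfRelDim g := hg₂
  -- the square onto `p₀`
  let pr₂ : A₂.X.left ⟶ Z₀ := pullback.fst (pullback.snd p₀ j₁) j₂ ≫ pullback.fst p₀ j₁
  have sq₂ : IsPullback pr₂ A₂.X.hom p₀ (j₂ ≫ j₁) :=
    (IsPullback.of_hasPullback (pullback.snd p₀ j₁) j₂).paste_horiz (IsPullback.of_hasPullback p₀ j₁)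
  -- the unit
  have hunit' : A₂.unitSection ≫ pr₂ = (j₂ ≫ j₁) ≫ ε₀ := by
    change (@MonObj.one _ _ _ (Over.mk (pullback.snd (pullback.snd p₀ j₁) j₂)) G.toMonObj).left ≫
        pullback.fst (pullback.snd p₀ j₁) j₂ ≫ pullback.fst p₀ j₁ = (j₂ ≫ j₁) ≫ ε₀
    rw [← Category.assoc, hunit, Category.assoc, hε₁', Category.assoc]
  -- the sections
  have hτ₁ : ∀ i, (((j₂ ≫ j₁) ≫ τ₀ i) ≫ p₀ = j₂ ≫ j₁) := fun i => by
    rw [Category.assoc, hτ₀, Category.comp_id]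
  let t₂ : ∀ i : Fin g ⊕ Fin g, H₂ ⟶ A₂.X.left := fun i =>
    pullback.lift (pullback.lift ((j₂ ≫ j₁) ≫ τ₀ i) j₂ (hτ₁ i)) (𝟙 H₂)
      (by rw [pullback.lift_snd, Category.id_comp])
  have ht₂ : ∀ i, t₂ i ≫ A₂.X.hom = 𝟙 H₂ := fun i => pullback.lift_snd _ _ _
  let σ₂ : Fin g ⊕ Fin g → A₂.Sections := fun i =>
    Over.homMk (t₂ i) (by rw [ht₂ i]; rfl)
  have hσ₂ : ∀ i, (σ₂ i).left ≫ pr₂ = (j₂ ≫ j₁) ≫ τ₀ i := fun i => by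
    change t₂ i ≫ pullback.fst (pullback.snd p₀ j₁) j₂ ≫ pullback.fst p₀ j₁ = _
    rw [← Category.assoc, pullback.lift_fst, pullback.lift_fst]
  -- the dual pair over `H₂` from `hF3` (Cor. 6.8: `A₂ → H₂` projective), normalised
  haveI : IsLocallyNoetherian H₂ := LocallyOfFiniteType.isLocallyNoetherian (j₂ ≫ j₁ ≫ f₀)
  have hproj₂ : IsProjective A₂.X.hom := (hproj.pullback_snd j₁).pullback_snd j₂
  obtain ⟨D₀⟩ := hF3' (j₂ ≫ j₁ ≫ f₀) A₂ hproj₂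
  let D₂ : A₂.DualPair := D₀.normalize
  have hD₂ := D₀.nonempty_unitHatSlice_iso_normalize
  -- the frame pulled back to `H₂`
  obtain ⟨eF⟩ := nonempty_pullbackFreeIso (j₂ ≫ j₁) (Fin (6 ^ g * polarizationDegree δ))
  refine ⟨H₁, j₁, hj₁, H₂, j₂, hj₂, A₂, pr₂, sq₂, hA₂, hunit', σ₂, hσ₂, D₂, hD₂, eF, hrep₁, ?_, ?_⟩
  · -- (II): the unit clause read through `ε₀`
    intro T v₁
    refine (hrep₂ v₁).trans ⟨?_, ?_⟩
    · rintro ⟨G', h1, h2⟩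
      exact ⟨G', by rw [← Category.assoc, h1, Category.assoc, hε₁', Category.assoc], h2⟩
    · rintro ⟨G', h1, h2⟩
      -- a section `e` of `Z₁ ×_{H₁} T → T` with `e ≫ pr ≫ pr = (v₁ ≫ j₁) ≫ ε₀` has `e ≫ pr = v₁ ≫ ε₁`
      have key : ∀ e : T ⟶ pullback (pullback.snd p₀ j₁) v₁, e ≫ pullback.snd (pullback.snd p₀ j₁) v₁ = 𝟙 T →
          e ≫ pullback.fst (pullback.snd p₀ j₁) v₁ ≫ pullback.fst p₀ j₁ = (v₁ ≫ j₁) ≫ ε₀ →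
            e ≫ pullback.fst (pullback.snd p₀ j₁) v₁ = v₁ ≫ ε₁ := by
        intro e he he'
        apply pullback.hom_ext
        · rw [Category.assoc, he', Category.assoc, Category.assoc, hε₁']
        · rw [Category.assoc, pullback.condition, ← Category.assoc, he, Category.id_comp, Category.assoc, hε₁,
            Category.comp_id]
      exact ⟨G', key _ (Over.w _) h1, h2⟩
  · -- (III)–(VI): FILE 1 over `H₂`
    intro hamp₂
    exact exists_isImmersion_iff_mfkLocus Cardinal.mk_le_aleph0 (j₂ ≫ j₁ ≫ f₀) A₂ hA₂ D₂ hD₂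
      ((Scheme.Modules.pullback pr₂).obj L₀) (hasRank_pullback _ hL₀) hamp₂ hN δ hδ σ₂
      (eF.inv ≫ (Scheme.Modules.pullback (j₂ ≫ j₁)).map u₀ ≫ pushforwardBaseChangeHom sq₂.w L₀)

/-! ## §2 The composite immersion `H ↪ H₀` and its universal property (storeys composed by (T1)) -/

omit [LocallyOfFiniteType f₀] [IsProper p₀] [Flat p₀] in
/-- **The three storeys compose** ([MumfordFogartyKirwan1994] Prop. 7.3: `H = H₆ ⊂ H₅ ⊂ ⋯ ⊂ H₁ ⊂ H₀`): for immersions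
`j₁ : H₁ ⟶ H₀`, `j₂ : H₂ ⟶ H₁`, `j : H ⟶ H₂` (monomorphisms) with universal properties `P₁`, `P₂`, `P`, a morphism `b : T ⟶ H₀`
factors uniquely through `j ≫ j₂ ≫ j₁` iff `P₁ b`, and for the factorisation `v₁` through `j₁`, `P₂ v₁`, and for the factorisation
`v` through `j₂`, `P v` — ★ (T1) `existsUnique_fac_comp_iff` twice.  With §1 this is the `T`-point description of the MFK sub-functor
over the raw base `H₀`. [cite: MumfordFogartyKirwan1994, Ch. 7 §2 Proposition 7.3 (pp. 132–134)] -/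
theorem existsUnique_comp_iff_of_storeys {H₁ H₂ H T : Scheme.{0}} (j₁ : H₁ ⟶ H₀) [Mono j₁] (j₂ : H₂ ⟶ H₁) [Mono j₂]
    (j : H ⟶ H₂) {P₁ : (T ⟶ H₀) → Prop} {P₂ : (T ⟶ H₁) → Prop} {P : (T ⟶ H₂) → Prop}
    (h₁ : ∀ b : T ⟶ H₀, (∃! v₁ : T ⟶ H₁, v₁ ≫ j₁ = b) ↔ P₁ b)
    (h₂ : ∀ v₁ : T ⟶ H₁, (∃! v : T ⟶ H₂, v ≫ j₂ = v₁) ↔ P₂ v₁)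
    (h : ∀ v : T ⟶ H₂, (∃! w : T ⟶ H, w ≫ j = v) ↔ P v) (b : T ⟶ H₀) :
    (∃! w : T ⟶ H, w ≫ j ≫ j₂ ≫ j₁ = b) ↔
      P₁ b ∧ ∃ v₁ : T ⟶ H₁, v₁ ≫ j₁ = b ∧ P₂ v₁ ∧ ∃ v : T ⟶ H₂, v ≫ j₂ = v₁ ∧ P v := by
  haveI : Mono (j₂ ≫ j₁) := mono_comp _ _
  rw [show (fun w : T ⟶ H => w ≫ j ≫ j₂ ≫ j₁ = b) = fun w => w ≫ j ≫ (j₂ ≫ j₁) = b from rfl,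
    existsUnique_fac_comp_iff (j₂ ≫ j₁) j b]
  constructor
  · rintro ⟨v₂, hv₂, hw⟩
    have hv₂' : (v₂ ≫ j₂) ≫ j₁ = b := (Category.assoc _ _ _).trans hv₂
    have hv₁ : ∃! v₁ : T ⟶ H₁, v₁ ≫ j₁ = b :=
      ⟨v₂ ≫ j₂, hv₂', fun v₁' hv₁' => (cancel_mono j₁).1 ((hv₁' : v₁' ≫ j₁ = b).trans hv₂'.symm)⟩
    refine ⟨(h₁ b).1 hv₁, v₂ ≫ j₂, hv₂', (h₂ (v₂ ≫ j₂)).1 ⟨v₂, rfl, fun v' hv' =>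
      (cancel_mono j₂).1 (hv' : v' ≫ j₂ = v₂ ≫ j₂)⟩, v₂, rfl, (h v₂).1 hw⟩
  · rintro ⟨-, v₁, hv₁, hP₂, v, hv, hP⟩
    refine ⟨v, by rw [← Category.assoc, hv, hv₁], (h v).2 hP⟩

end AbelianSchemeOver

end Literature.AlgebraicGeometry.AbelianSchemes

end
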